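import Mathlib
import Literature.NumberTheory.Automorphic.HilbertModularFormQExpansion
import Literature.Analysis.Complex.LocallyUniformLimitSCV
import Summits.Langlands.Langlands.Theorems.CapacityClassicalityHilbertIntegralOverconvergentIsCongruenceStubQSeriesHolomorphic
import Summits.Langlands.Langlands.Theorems.CapacityClassicalityHilbertIntegralOverconvergentIsCongruenceKoecherGlue
import Summits.Langlands.Langlands.Theorems.CapacityClassicalityHilbertIntegralOverconvergentIsCongruenceStubTotallyRealEmbeddings

/-!
# The dual theta series: holomorphy and `𝔡`-periodicity (stub `stub_thetaDual_props` of line Sketch-ideate-r1-k1)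

Section V of line Sketch-ideate-r1-k1 of the crux `HilbertIntegralOverconvergentIsCongruence`
(stmt-Langlands-8485) studies the theta series of one square over a totally real field `F`.  The
inversion `z ↦ -1/z` exchanges it with the dual theta series
`Θ'(z) = ∑_{ξ ∈ D} e^{2πi S(ξ² z)}`, `D = {ν ∈ F : Tr(ν a) ∈ ℤ ∀ a ∈ 𝓞 F} = 𝔡⁻¹`.
This file proves the registered stub `stub_thetaDual_props`, the two properties of `Θ'` needed by
the assembly:

* `Θ'` is holomorphic on `ℍ = halfSpace F`: since `d_F ∈ 𝔡` (Mathlib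
  `NumberField.discr_mem_differentIdeal`) and `𝔡⁻¹ · 𝔡 = 𝓞 F`, the map `ξ ↦ d_F ξ` embeds `D`
  into `𝓞 F`, so the Gaussian majorant `∑_{ξ ∈ D} e^{-2π ∑_σ y_σ σ(ξ)²}` is a subseries of the
  (assumed summable) `𝓞 F`-Gaussian at height `y / d_F²`; on the open box of heights
  `{Im z₀_σ / 2 < Im z_σ < 2 Im z₀_σ}` every term is dominated by the majorant at the lower corner
  (`σ(ξ²) = σ(ξ)² ≥ 0`), and the several-variable Weierstrass `M`-test
  `Literature.Analysis.Complex.SCV.analyticOnNhd_tsum_of_summable_norm` gives analyticity.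
* `Θ'` is periodic under the different ideal `𝔡 = differentIdeal ℤ (𝓞 F)`: for `ξ ∈ D = dual(1)`
  and `c ∈ 𝔡 = dual(1)⁻¹` (Mathlib `coeIdeal_differentIdeal`) one has `ξ c ∈ 𝓞 F`, hence
  `∑_σ σ(ξ²) σ(c) = ∑_σ σ(ξ) σ(ξ c) = Tr(ξ · ξc) ∈ ℤ` and `e^{2πi n} = 1` termwise.
-/

set_option linter.dupNamespace false

noncomputable section

namespace Summit.Langlands.Langlands.Theorems.HilbertIntegralOverconvergentIsCongruence

open MeasureTheory Complex NumberField
open Literature.NumberTheory.Automorphic Literature.NumberTheory.Automorphic.HilbertModular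
open scoped MatrixGroups nonZeroDivisors

/-- `𝔡⁻¹ · 𝔡 ⊆ 𝓞 F`: if `Tr(ξ a) ∈ ℤ` for all `a ∈ 𝓞 F` (i.e. `ξ ∈ 𝔡⁻¹ = dual(1)`) and `c` lies in
the different ideal `𝔡 = dual(1)⁻¹`, then `ξ c ∈ 𝓞 F`. [folklore] -/
theorem tdp_mul_mem_ringOfIntegers {F : Type} [Field F] [NumberField F] {ξ : F}
    (hξ : ∀ a : 𝓞 F, ∃ n : ℤ, Algebra.trace ℚ F (ξ * a) = n) {c : 𝓞 F}
    (hc : c ∈ differentIdeal ℤ (𝓞 F)) : ∃ a : 𝓞 F, (a : F) = ξ * c := by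
  classical
  set D : FractionalIdeal (𝓞 F)⁰ F :=
    ((differentIdeal ℤ (𝓞 F) : Ideal (𝓞 F)) : FractionalIdeal (𝓞 F)⁰ F) with hD
  have hD0 : D ≠ 0 := by
    rw [hD, FractionalIdeal.coeIdeal_ne_zero]
    intro h
    have := NumberField.absNorm_differentIdeal F (𝓞 F)
    rw [h, Ideal.absNorm_bot] at this
    exact (Int.natAbs_ne_zero.2 (NumberField.discr_ne_zero F)) this.symm
  have hdual : FractionalIdeal.dual ℤ ℚ (1 : FractionalIdeal (𝓞 F)⁰ F) = D⁻¹ := by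
    rw [hD, coeIdeal_differentIdeal ℤ ℚ F, inv_inv]
  have hξ' : ξ ∈ FractionalIdeal.dual ℤ ℚ (1 : FractionalIdeal (𝓞 F)⁰ F) := by
    rw [FractionalIdeal.mem_dual (one_ne_zero' (FractionalIdeal (𝓞 F)⁰ F))]
    intro a ha
    obtain ⟨a', rfl⟩ := (FractionalIdeal.mem_one_iff _).1 ha
    obtain ⟨n, hn⟩ := hξ a'
    rw [Algebra.traceForm_apply]
    exact ⟨n, by rw [eq_intCast]; exact hn.symm⟩
  have hcD : (c : F) ∈ D := FractionalIdeal.mem_coeIdeal_of_mem (𝓞 F)⁰ hc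
  have hmem : ξ * c ∈ FractionalIdeal.dual ℤ ℚ (1 : FractionalIdeal (𝓞 F)⁰ F) * D :=
    FractionalIdeal.mul_mem_mul hξ' hcD
  rw [hdual, inv_mul_cancel₀ hD0, FractionalIdeal.mem_one_iff] at hmem
  obtain ⟨a, ha⟩ := hmem
  exact ⟨a, ha⟩

/-- `d_F · 𝔡⁻¹ ⊆ 𝓞 F`: if `Tr(ξ a) ∈ ℤ` for all `a ∈ 𝓞 F`, then `ξ d_F ∈ 𝓞 F` (the discriminant
`d_F` lies in the different ideal, Mathlib `NumberField.discr_mem_differentIdeal`). [folklore] -/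
theorem tdp_mul_discr_mem {F : Type} [Field F] [NumberField F] {ξ : F}
    (hξ : ∀ a : 𝓞 F, ∃ n : ℤ, Algebra.trace ℚ F (ξ * a) = n) :
    ∃ a : 𝓞 F, (a : F) = ξ * (NumberField.discr F : F) := by
  obtain ⟨a, ha⟩ := tdp_mul_mem_ringOfIntegers hξ (NumberField.discr_mem_differentIdeal F (𝓞 F))
  refine ⟨a, ?_⟩
  rw [ha]
  exact congrArg (ξ * ·) (map_intCast (algebraMap (𝓞 F) F) _)

/-- The Gaussian majorant of the dual theta series is summable at every height `y ≫ 0`, granted the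
`𝓞 F`-Gaussian summability: `ξ ↦ d_F ξ` embeds `𝔡⁻¹` into `𝓞 F` and
`e^{-2π ∑_σ y_σ σ(ξ)²} = e^{-2π ∑_σ (y_σ / d_F²) σ(d_F ξ)²}`, a subseries of the `𝓞 F`-Gaussian at
height `y / d_F²`. [folklore] -/
theorem tdp_summable_gauss_dual {F : Type} [Field F] [NumberField F]
    (hgauss : ∀ y : (F →+* ℝ) → ℝ, (∀ σ, 0 < y σ) →
      Summable (fun x : 𝓞 F ↦ Real.exp (-(2 * Real.pi * ∑ σ : F →+* ℝ, y σ * σ (x : F) ^ 2))))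
    (y : (F →+* ℝ) → ℝ) (hy : ∀ σ, 0 < y σ) :
    Summable (fun ξ : {ν : F | ∀ a : 𝓞 F, ∃ n : ℤ, Algebra.trace ℚ F (ν * a) = n} ↦
      Real.exp (-(2 * Real.pi * ∑ σ : F →+* ℝ, y σ * σ (ξ : F) ^ 2))) := by
  have hN0 : ((NumberField.discr F : ℤ) : ℝ) ≠ 0 := by exact_mod_cast NumberField.discr_ne_zero F
  have hNF : ((NumberField.discr F : ℤ) : F) ≠ 0 := by exact_mod_cast NumberField.discr_ne_zero F
  -- the embedding `ξ ↦ d_F ξ` of `𝔡⁻¹` into `𝓞 F`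
  have hmem : ∀ ξ : {ν : F | ∀ a : 𝓞 F, ∃ n : ℤ, Algebra.trace ℚ F (ν * a) = n},
      ∃ a : 𝓞 F, (a : F) = (ξ : F) * (NumberField.discr F : F) := fun ξ ↦ tdp_mul_discr_mem ξ.2
  choose φ hφ using hmem
  have hφinj : Function.Injective φ := by
    intro ξ₁ ξ₂ h
    have h' := congrArg (fun a : 𝓞 F ↦ (a : F)) h
    simp only [hφ] at h'
    exact Subtype.ext (mul_right_cancel₀ hNF h')
  have hy' : ∀ σ, 0 < y σ / ((NumberField.discr F : ℤ) : ℝ) ^ 2 := fun σ ↦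
    div_pos (hy σ) (sq_pos_iff.mpr hN0)
  refine ((hgauss (fun σ ↦ y σ / ((NumberField.discr F : ℤ) : ℝ) ^ 2) hy').comp_injective
    hφinj).congr fun ξ ↦ ?_
  have hsum : ∑ σ : F →+* ℝ, y σ / ((NumberField.discr F : ℤ) : ℝ) ^ 2 *
        (σ (ξ : F) * ((NumberField.discr F : ℤ) : ℝ)) ^ 2 =
      ∑ σ : F →+* ℝ, y σ * σ (ξ : F) ^ 2 := by
    refine Finset.sum_congr rfl fun σ _ ↦ ?_
    rw [div_mul_eq_mul_div, div_eq_iff (pow_ne_zero 2 hN0)]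
    ring
  simp only [Function.comp_apply, hφ, map_mul, map_intCast]
  rw [hsum]

/-- **Holomorphy of the dual theta series.** Granted the `𝓞 F`-Gaussian summability,
`Θ'(z) = ∑_{ξ ∈ 𝔡⁻¹} e^{2πi S(ξ² z)}` is holomorphic on `ℍ`: normal convergence on the open box of
heights `{Im z₀_σ / 2 < Im z_σ < 2 Im z₀_σ}` (termwise domination by the Gaussian majorant at the
lower corner, as `σ(ξ²) = σ(ξ)² ≥ 0`), then the several-variable Weierstrass `M`-test
`Literature.Analysis.Complex.SCV.analyticOnNhd_tsum_of_summable_norm`. [folklore] -/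
theorem tdp_thetaDual_holomorphic {F : Type} [Field F] [NumberField F]
    (hgauss : ∀ y : (F →+* ℝ) → ℝ, (∀ σ, 0 < y σ) →
      Summable (fun x : 𝓞 F ↦ Real.exp (-(2 * Real.pi * ∑ σ : F →+* ℝ, y σ * σ (x : F) ^ 2)))) :
    IsHolomorphicOn F (fun z ↦ ∑' ξ : {ν : F | ∀ a : 𝓞 F, ∃ n : ℤ, Algebra.trace ℚ F (ν * a) = n},
        cexp (2 * Real.pi * I * pairing ((ξ : F) ^ 2) z)) := by
  classical
  intro z₀ hz₀
  have hz₀' : ∀ σ, 0 < (z₀ σ).im := mem_halfSpace_iff.1 hz₀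
  -- the open box of heights around `z₀`
  set y : (F →+* ℝ) → ℝ := fun σ ↦ (z₀ σ).im / 2 with hy
  set Y : (F →+* ℝ) → ℝ := fun σ ↦ 2 * (z₀ σ).im with hY
  set U : Set (Point F) := {z | ∀ σ, y σ < (z σ).im ∧ (z σ).im < Y σ}
  have hz₀U : z₀ ∈ U := fun σ ↦ ⟨by rw [hy]; linarith [hz₀' σ], by rw [hY]; linarith [hz₀' σ]⟩
  have hypos : ∀ σ, 0 < y σ := fun σ ↦ by rw [hy]; exact half_pos (hz₀' σ)
  -- the summable majorant at the lower corner `y`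
  have hu := tdp_summable_gauss_dual hgauss y hypos
  -- termwise domination on the box
  have hbound : ∀ ξ : {ν : F | ∀ a : 𝓞 F, ∃ n : ℤ, Algebra.trace ℚ F (ν * a) = n}, ∀ z ∈ U,
      ‖cexp (2 * Real.pi * I * pairing ((ξ : F) ^ 2) z)‖ ≤
        Real.exp (-(2 * Real.pi * ∑ σ : F →+* ℝ, y σ * σ (ξ : F) ^ 2)) := by
    intro ξ z hz
    rw [Complex.norm_exp, bcs_re_phase]
    refine Real.exp_le_exp.2 (neg_le_neg (mul_le_mul_of_nonneg_left ?_ (by positivity)))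
    refine Finset.sum_le_sum fun σ _ ↦ ?_
    rw [map_pow, mul_comm (y σ)]
    exact mul_le_mul_of_nonneg_left (hz σ).1.le (sq_nonneg _)
  have hana := Literature.Analysis.Complex.SCV.analyticOnNhd_tsum_of_summable_norm
    (f := fun (ξ : {ν : F | ∀ a : 𝓞 F, ∃ n : ℤ, Algebra.trace ℚ F (ν * a) = n}) (z : Point F) ↦
      cexp (2 * Real.pi * I * pairing ((ξ : F) ^ 2) z))
    (qsh_isOpen_box y Y)
    (fun ξ ↦ (((qsh_differentiable_pairing ((ξ : F) ^ 2)).const_mul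
      (2 * Real.pi * I)).cexp).differentiableOn)
    hu hbound
  exact (hana z₀ hz₀U).differentiableAt.differentiableWithinAt

/-- **`𝔡`-periodicity of the dual theta series** (termwise, at every point): for `c` in the
different ideal and `ξ ∈ 𝔡⁻¹`, `ξ c ∈ 𝓞 F`, so `S(ξ²(z + c)) = S(ξ² z) + n` with
`n = ∑_σ σ(ξ) σ(ξ c) = Tr(ξ · ξ c) ∈ ℤ`, and `e^{2πi n} = 1`. [folklore] -/
theorem tdp_thetaDual_periodic {F : Type} [Field F] [NumberField F] [NumberField.IsTotallyReal F]
    {c : 𝓞 F} (hc : c ∈ differentIdeal ℤ (𝓞 F)) (z : Point F) :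
    (∑' ξ : {ν : F | ∀ a : 𝓞 F, ∃ n : ℤ, Algebra.trace ℚ F (ν * a) = n},
        cexp (2 * Real.pi * I * pairing ((ξ : F) ^ 2) (fun σ ↦ z σ + ((σ (c : F) : ℝ) : ℂ)))) =
      ∑' ξ : {ν : F | ∀ a : 𝓞 F, ∃ n : ℤ, Algebra.trace ℚ F (ν * a) = n},
        cexp (2 * Real.pi * I * pairing ((ξ : F) ^ 2) z) := by
  obtain ⟨htr, -⟩ := stub_totallyReal_embeddings F
  refine tsum_congr fun ξ ↦ ?_
  obtain ⟨a, ha⟩ := tdp_mul_mem_ringOfIntegers ξ.2 hc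
  obtain ⟨n, hn⟩ := koe_sum_mul_embedding_int htr ξ.2 a
  have hreal : ∑ σ : F →+* ℝ, σ ((ξ : F) ^ 2) * σ (c : F) = n := by
    rw [← hn]
    refine Finset.sum_congr rfl fun σ _ ↦ ?_
    rw [ha, map_mul, map_pow]
    ring
  have hphase : pairing ((ξ : F) ^ 2) (fun σ ↦ z σ + ((σ (c : F) : ℝ) : ℂ)) =
      pairing ((ξ : F) ^ 2) z + n := by
    simp only [pairing, mul_add, Finset.sum_add_distrib]
    congr 1
    exact_mod_cast hreal
  rw [hphase, mul_add, Complex.exp_add]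
  have h1 : cexp (2 * Real.pi * I * (n : ℂ)) = 1 := by
    rw [show 2 * Real.pi * I * (n : ℂ) = n * (2 * Real.pi * I) by ring]
    exact Complex.exp_int_mul_two_pi_mul_I n
  rw [h1, mul_one]

/-- **stub V2 — `stub_thetaDual_props` (M; the dual theta series).** Granting the lattice Gaussian summability over `𝓞F` (V1's first
clause, a hypothesis here), the dual theta `Θ'(z) = ∑_{ξ ∈ 𝔡⁻¹} e^{2πi S(ξ² z)}` is holomorphic on `ℍ` (`|d_F|·𝔡⁻¹ ⊆ 𝓞F`, so its
Gaussian majorants are sub-sums of `𝓞F`-Gaussians at `y/|d_F|²`; then the landed several-variable Weierstrass argument of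
`stub_qSeries_holomorphic` over the index set of squares, or termwise), and `Θ'` is periodic under the different ideal `𝔡`
(`ξ ∈ 𝔡⁻¹ = dual(1)`, `c ∈ 𝔡 ⇒ ξc ∈ 𝓞F ⇒ Tr(ξ²c) ∈ ℤ`). [folklore] -/
theorem stub_thetaDual_props (F : Type) [Field F] [NumberField F] [NumberField.IsTotallyReal F]
    (hgauss : ∀ y : (F →+* ℝ) → ℝ, (∀ σ, 0 < y σ) →
      Summable (fun x : 𝓞 F ↦ Real.exp (-(2 * Real.pi * ∑ σ : F →+* ℝ, y σ * σ (x : F) ^ 2)))) :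
    IsHolomorphicOn F (fun z ↦ ∑' ξ : {ν : F | ∀ a : 𝓞 F, ∃ n : ℤ, Algebra.trace ℚ F (ν * a) = n},
        cexp (2 * Real.pi * I * pairing ((ξ : F) ^ 2) z)) ∧
    ∀ c : 𝓞 F, c ∈ differentIdeal ℤ (𝓞 F) → ∀ z : Point F,
      (∑' ξ : {ν : F | ∀ a : 𝓞 F, ∃ n : ℤ, Algebra.trace ℚ F (ν * a) = n},
          cexp (2 * Real.pi * I * pairing ((ξ : F) ^ 2) (fun σ ↦ z σ + ((σ (c : F) : ℝ) : ℂ)))) =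
        ∑' ξ : {ν : F | ∀ a : 𝓞 F, ∃ n : ℤ, Algebra.trace ℚ F (ν * a) = n},
          cexp (2 * Real.pi * I * pairing ((ξ : F) ^ 2) z) := by
  exact ⟨tdp_thetaDual_holomorphic hgauss, fun c hc z ↦ tdp_thetaDual_periodic hc z⟩

end Summit.Langlands.Langlands.Theorems.HilbertIntegralOverconvergentIsCongruence
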